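import Mathlib
import Literature.Analysis.FluidPDE.VectorCalculus
import Literature.Analysis.FluidPDE.ClassicalSolutionRescale
import Summits.NavierStokesRegularity.NavierStokesRegularity.Theses.SlicedKelvin

/-!
# Crux `SlicedKelvin.FluxZoom` (stmt-NavierStokesRegularity-15603), line `registered`,
# stub `stub_zoomBookkeeping`: scaling bookkeeping of the zoom `c • stPull (c²) c t₀ x₀ u`

Support file (theorems only, `--supports stmt-NavierStokesRegularity-15603`) for the lead's
skeleton of the crux `FluxZoom` of route `SlicedKelvin`. The crux zooms in on a classical solution
`u` around a near-record vorticity point `(t₀, x₀)` by the parabolic rescaling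

  `v(s, y) = c u(t₀ + c² s, x₀ + c y) = (c • stPull (c²) c t₀ x₀ u) s y`,

`c² = 1 / |ω(t₀, x₀)|`. This file proves the three scaling identities of the slices
`v(s) = c • u(t₀ + c² s)(x₀ + c ·)` that the core stub consumes:

1. the energy picks up `c⁻¹`: `∫ |v(s, y)|² dy = c⁻¹ ∫ |u(t₀ + c² s, x)|² dx` (unconditionally:
   the affine change of variables `y ↦ x₀ + c y` is an identity of lower Lebesgue integrals for
   every function, `lintegral_comp_space_affine`);
2. for a differentiable slice, the vorticity picks up `c²` (chain rule):
   `curl v(s) (y) = c² curl u(t₀ + c² s) (x₀ + c y)`;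
3. for a differentiable slice, the unsigned flux of the vorticity through a plane is
   scale invariant: the flux of `curl v(s)` through the plane `R {y₂ = c'}` (`R` a linear
   isometry) equals the flux of `curl u(t₀ + c² s)` through the plane `R {y₂ = (R⁻¹ x₀)₂ + c c'}`;
   the factor `c²` of (2) cancels the Jacobian `c⁻²` of the induced affine map
   `y ↦ (R⁻¹x₀)' + c y` of the plane parameters `ℝ²`.

The proofs are adapted from the (private) helpers `fderiv_zoom`, `curl_zoom`, `lintegral_zoom`,
`zoom_plane_point` of `Theorems/SlicedKelvinFluxZoomStubFluxVelocity.lean`, applied to the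
time-independent field `u(t₀ + c² s)`.

No named fact is assumed: every ingredient is a theorem of Mathlib or of the tree
(`Literature.Analysis.FluidPDE.lintegral_comp_space_affine`, `SpaceTimeRescaling.lean`;
`smul_stPull_slice`, `ClassicalSolutionRescale.lean`).

## References

* G. Koch, N. Nadirashvili, G. Seregin, V. Šverák, *Liouville theorems for the Navier–Stokes
  equations and applications*, Acta Math. 203 (2009), §6, (6.2) (the zoom
  `v^{(k)}(y, s) = M_k⁻¹ u(x_k + y/M_k, t_k + s/M_k²)`) [KochNadirashviliSereginSverak2009].
* P. G. Lemarié-Rieusset, *The Navier–Stokes Problem in the 21st Century* (2016), §11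
  (scaling) [LemarieRieusset2016].
-/

noncomputable section

-- the summit and its single sub-problem share the name (CONVENTIONS §1), as in every Theorems file
set_option linter.dupNamespace false

open MeasureTheory InnerProductSpace
open scoped ENNReal RealInnerProductSpace

namespace Summit.NavierStokesRegularity.NavierStokesRegularity.Theorems.FluxZoom.Registered

open Literature.Analysis.FluidPDE

/-! ### The zoom `y ↦ ℓ v(x + ℓ y)` of a time-independent field -/

-- adapted from SlicedKelvinFluxZoomStubFluxVelocity (`fderiv_zoom`)
/-- Chain rule for the zoomed field: `D(ℓ v(x + ℓ ·))(y) = ℓ² Dv(x + ℓ y)` for differentiable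
`v`. -/
private theorem fderiv_zoom {v : EuclideanSpace ℝ (Fin 3) → EuclideanSpace ℝ (Fin 3)}
    (hv : Differentiable ℝ v) (x : EuclideanSpace ℝ (Fin 3)) (ℓ : ℝ)
    (y : EuclideanSpace ℝ (Fin 3)) :
    fderiv ℝ (fun y => ℓ • v (x + ℓ • y)) y = (ℓ ^ 2) • fderiv ℝ v (x + ℓ • y) := by
  have hg : Differentiable ℝ fun y : EuclideanSpace ℝ (Fin 3) => v (x + ℓ • y) :=
    hv.comp ((differentiable_const _).add (differentiable_id.const_smul ℓ))
  rw [fderiv_fun_const_smul (hg y)]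
  have h := fderiv_comp_smul (𝕜 := ℝ) (f := fun z => v (x + z)) (x := y) ℓ
  rw [fderiv_comp_add_left] at h
  rw [h, smul_smul, pow_two]

-- adapted from SlicedKelvinFluxZoomStubFluxVelocity (`curl_zoom`)
/-- The curl of the zoomed field: `curl (ℓ v(x + ℓ ·))(y) = ℓ² curl v(x + ℓ y)`. -/
private theorem curl_zoom {v : EuclideanSpace ℝ (Fin 3) → EuclideanSpace ℝ (Fin 3)}
    (hv : Differentiable ℝ v) (x : EuclideanSpace ℝ (Fin 3)) (ℓ : ℝ)
    (y : EuclideanSpace ℝ (Fin 3)) :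
    curl (fun y => ℓ • v (x + ℓ • y)) y = (ℓ ^ 2) • curl v (x + ℓ • y) := by
  simp only [curl, fderiv_zoom hv x ℓ y, _root_.smul_apply, PiLp.smul_apply,
    smul_eq_mul]
  ext i
  fin_cases i <;> simp <;> ring

-- adapted from SlicedKelvinFluxZoomStubFluxVelocity (`zoom_plane_point`)
/-- A point of the plane `R⁻¹x + ℓ · {y₂ = c}` in the coordinates of the statement: with
`a = R⁻¹ x`, `x + ℓ R(y₀, y₁, c) = R(a₀ + ℓ y₀, a₁ + ℓ y₁, a₂ + ℓ c)`. -/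
private theorem zoom_plane_point (R : EuclideanSpace ℝ (Fin 3) ≃ₗᵢ[ℝ] EuclideanSpace ℝ (Fin 3))
    (x : EuclideanSpace ℝ (Fin 3)) (ℓ c : ℝ) (y : EuclideanSpace ℝ (Fin 2)) :
    x + ℓ • R (WithLp.toLp 2 ![y 0, y 1, c]) =
      R (WithLp.toLp 2
        ![(WithLp.toLp 2 ![R.symm x 0, R.symm x 1] + ℓ • y : EuclideanSpace ℝ (Fin 2)) 0,
          (WithLp.toLp 2 ![R.symm x 0, R.symm x 1] + ℓ • y : EuclideanSpace ℝ (Fin 2)) 1,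
          R.symm x 2 + ℓ * c]) := by
  have h : (WithLp.toLp 2
        ![(WithLp.toLp 2 ![R.symm x 0, R.symm x 1] + ℓ • y : EuclideanSpace ℝ (Fin 2)) 0,
          (WithLp.toLp 2 ![R.symm x 0, R.symm x 1] + ℓ • y : EuclideanSpace ℝ (Fin 2)) 1,
          R.symm x 2 + ℓ * c] : EuclideanSpace ℝ (Fin 3)) =
      R.symm x + ℓ • WithLp.toLp 2 ![y 0, y 1, c] := by
    ext i
    fin_cases i <;> simp
  rw [h, map_add, LinearIsometryEquiv.map_smul, LinearIsometryEquiv.apply_symm_apply]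

/-! ### The slices of the zoom `c • stPull (c²) c t₀ x₀ u` -/

/-- **(i) Energy of the zoomed slice.** `∫ |c u(t₀ + c²s, x₀ + c y)|² dy = c⁻¹ ∫ |u(t₀ + c²s)|²`
(`c > 0`; `c² · c⁻³ = c⁻¹`), for every (not necessarily measurable) `u`. -/
private theorem lintegral_zoomSlice
    (u : ℝ → EuclideanSpace ℝ (Fin 3) → EuclideanSpace ℝ (Fin 3)) (t₀ : ℝ)
    (x₀ : EuclideanSpace ℝ (Fin 3)) {c : ℝ} (hc : 0 < c) (s : ℝ) :
    ∫⁻ y, ‖(c • stPull (c ^ 2) c t₀ x₀ u) s y‖ₑ ^ 2 =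
      ENNReal.ofReal c⁻¹ * ∫⁻ x, ‖u (t₀ + c ^ 2 * s) x‖ₑ ^ 2 := by
  have h1 : ∀ y, ‖(c • stPull (c ^ 2) c t₀ x₀ u) s y‖ₑ ^ 2 =
      ENNReal.ofReal (c ^ 2) * ‖u (t₀ + c ^ 2 * s) (x₀ + c • y)‖ₑ ^ 2 := by
    intro y
    rw [smul_stPull_apply, enorm_smul, mul_pow, Real.enorm_eq_ofReal hc.le,
      ← ENNReal.ofReal_pow hc.le]
  simp_rw [h1]
  rw [lintegral_const_mul' _ _ ENNReal.ofReal_ne_top,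
    lintegral_comp_space_affine hc x₀ (fun z => ‖u (t₀ + c ^ 2 * s) z‖ₑ ^ 2),
    finrank_euclideanSpace_fin, ← mul_assoc, ← ENNReal.ofReal_mul (sq_nonneg c)]
  congr 2
  field_simp

/-- **(ii) Vorticity of the zoomed slice.** For a differentiable slice `u(t₀ + c² s)`,
`curl (c u(t₀ + c²s, x₀ + c ·))(y) = c² curl u(t₀ + c²s)(x₀ + c y)` (chain rule). -/
private theorem curl_zoomSlice
    (u : ℝ → EuclideanSpace ℝ (Fin 3) → EuclideanSpace ℝ (Fin 3)) (t₀ : ℝ)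
    (x₀ : EuclideanSpace ℝ (Fin 3)) (c s : ℝ) (hd : Differentiable ℝ (u (t₀ + c ^ 2 * s)))
    (y : EuclideanSpace ℝ (Fin 3)) :
    curl ((c • stPull (c ^ 2) c t₀ x₀ u) s) y =
      c ^ 2 • curl (u (t₀ + c ^ 2 * s)) (x₀ + c • y) := by
  rw [smul_stPull_slice]
  exact curl_zoom hd x₀ c y

/-- **(iii) Scale invariance of the unsigned planar flux of the vorticity.** For a
differentiable slice, the flux of `curl (c u(t₀ + c²s, x₀ + c ·))` through the plane
`R {y₂ = c'}` equals the flux of `curl u(t₀ + c²s)` through the plane `R {y₂ = (R⁻¹x₀)₂ + c c'}`: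
the factor `c²` of the curl cancels the Jacobian `c⁻²` of `y ↦ (R⁻¹x₀)' + c y` on `ℝ²`. -/
private theorem lintegral_flux_zoomSlice
    (u : ℝ → EuclideanSpace ℝ (Fin 3) → EuclideanSpace ℝ (Fin 3)) (t₀ : ℝ)
    (x₀ : EuclideanSpace ℝ (Fin 3)) {c : ℝ} (hc : 0 < c) (s : ℝ)
    (hd : Differentiable ℝ (u (t₀ + c ^ 2 * s)))
    (R : EuclideanSpace ℝ (Fin 3) ≃ₗᵢ[ℝ] EuclideanSpace ℝ (Fin 3)) (c' : ℝ) :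
    ∫⁻ y : EuclideanSpace ℝ (Fin 2),
        ‖⟪curl ((c • stPull (c ^ 2) c t₀ x₀ u) s) (R (WithLp.toLp 2 ![y 0, y 1, c'])),
          R (EuclideanSpace.single 2 1)⟫‖ₑ =
      ∫⁻ y : EuclideanSpace ℝ (Fin 2),
        ‖⟪curl (u (t₀ + c ^ 2 * s)) (R (WithLp.toLp 2 ![y 0, y 1, R.symm x₀ 2 + c * c'])),
          R (EuclideanSpace.single 2 1)⟫‖ₑ := by
  -- the plane `R {y₂ = c'}` of the zoomed slice is the plane `R {y₂ = a₂ + c c'}` of the slice,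
  -- `a = R⁻¹ x₀`, parametrised by `a' + c y`, `a' = (a₀, a₁)`
  set a' : EuclideanSpace ℝ (Fin 2) := WithLp.toLp 2 ![R.symm x₀ 0, R.symm x₀ 1] with ha'
  set G : EuclideanSpace ℝ (Fin 2) → ℝ≥0∞ := fun z =>
    ‖⟪curl (u (t₀ + c ^ 2 * s)) (R (WithLp.toLp 2 ![z 0, z 1, R.symm x₀ 2 + c * c'])),
      R (EuclideanSpace.single 2 1)⟫‖ₑ with hG
  have hpt : ∀ y : EuclideanSpace ℝ (Fin 2),
      ‖⟪curl ((c • stPull (c ^ 2) c t₀ x₀ u) s) (R (WithLp.toLp 2 ![y 0, y 1, c'])),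
          R (EuclideanSpace.single 2 1)⟫‖ₑ =
        ENNReal.ofReal (c ^ 2) * G (a' + c • y) := by
    intro y
    rw [curl_zoomSlice u t₀ x₀ c s hd, zoom_plane_point R x₀ c c' y, real_inner_smul_left,
      enorm_mul, Real.enorm_eq_ofReal (sq_nonneg c)]
  rw [lintegral_congr hpt, lintegral_const_mul' _ _ ENNReal.ofReal_ne_top,
    lintegral_comp_space_affine hc a' G, finrank_euclideanSpace_fin, ← mul_assoc,
    ← ENNReal.ofReal_mul (sq_nonneg c), mul_inv_cancel₀ (pow_ne_zero 2 hc.ne'),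
    ENNReal.ofReal_one, one_mul]

/-! ### The stub -/

/-- **Stub `stub_zoomBookkeeping` of the crux `SlicedKelvin.FluxZoom`, line `registered`:
scaling bookkeeping of the zoom `v = c • stPull (c²) c t₀ x₀ u`,
`v(s, y) = c u(t₀ + c² s, x₀ + c y)` (`c > 0`).** For every slice `s`:
(i) `∫ |v(s)|² = c⁻¹ ∫ |u(t₀ + c² s)|²` (`lintegral_comp_space_affine`, no measurability needed);
and, if the slice `u(t₀ + c² s)` is differentiable,
(ii) `curl v(s) (y) = c² curl u(t₀ + c² s) (x₀ + c y)` (chain rule), and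
(iii) the unsigned flux of `curl v(s)` through the plane `R {y₂ = c'}` equals that of
`curl u(t₀ + c² s)` through `R {y₂ = (R⁻¹ x₀)₂ + c c'}` (the factor `c²` of (ii) against the
Jacobian `c⁻²` of `y ↦ (R⁻¹ x₀)' + c y` on `ℝ²`). -/
theorem stub_zoomBookkeeping :
    ∀ (u : ℝ → EuclideanSpace ℝ (Fin 3) → EuclideanSpace ℝ (Fin 3)) (t₀ : ℝ)
      (x₀ : EuclideanSpace ℝ (Fin 3)) (c : ℝ), 0 < c → ∀ s : ℝ,
      (∫⁻ y, ‖(c • Literature.Analysis.FluidPDE.stPull (c ^ 2) c t₀ x₀ u) s y‖ₑ ^ 2 =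
          ENNReal.ofReal c⁻¹ * ∫⁻ x, ‖u (t₀ + c ^ 2 * s) x‖ₑ ^ 2) ∧
      (Differentiable ℝ (u (t₀ + c ^ 2 * s)) →
        (∀ y, Literature.Analysis.FluidPDE.curl ((c • Literature.Analysis.FluidPDE.stPull (c ^ 2) c t₀ x₀ u) s) y =
          c ^ 2 • Literature.Analysis.FluidPDE.curl (u (t₀ + c ^ 2 * s)) (x₀ + c • y)) ∧
        (∀ (R : EuclideanSpace ℝ (Fin 3) ≃ₗᵢ[ℝ] EuclideanSpace ℝ (Fin 3)) (c' : ℝ),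
          ∫⁻ y : EuclideanSpace ℝ (Fin 2),
            ‖inner ℝ (Literature.Analysis.FluidPDE.curl
                ((c • Literature.Analysis.FluidPDE.stPull (c ^ 2) c t₀ x₀ u) s)
                (R (WithLp.toLp 2 ![y 0, y 1, c']))) (R (EuclideanSpace.single 2 1))‖ₑ =
          ∫⁻ y : EuclideanSpace ℝ (Fin 2),
            ‖inner ℝ (Literature.Analysis.FluidPDE.curl (u (t₀ + c ^ 2 * s))
                (R (WithLp.toLp 2 ![y 0, y 1, (R.symm x₀) 2 + c * c']))) (R (EuclideanSpace.single 2 1))‖ₑ)) := by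
  intro u t₀ x₀ c hc s
  exact ⟨lintegral_zoomSlice u t₀ x₀ hc s, fun hd =>
    ⟨curl_zoomSlice u t₀ x₀ c s hd, lintegral_flux_zoomSlice u t₀ x₀ hc s hd⟩⟩

end Summit.NavierStokesRegularity.NavierStokesRegularity.Theorems.FluxZoom.Registered

end
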